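import Summits.QuantumFields.BalabanUV.Beta.EriceRemainderEnclosureHistoryAutonomyComparisonNonlinearLevelGaugeBase

/-!
# EriceRemainderEnclosureHistoryAutonomyComparisonNonlinearLevelGauge — (E118e) **THE NONLINEAR LEVEL GAUGE AND COMPARISON AT ANY SIZE FOR THE CONSTANT EXCESS.**
# `B u = β₀ + Σ_{k<K} L_k·u_k` (`β₀ > 0`, `L ≥ 0`, `L_0 = 0`; the profile, the range `K` and all sizes ARBITRARY), `B′ = B + η` (`η ≥ 0`).  Then:
# (**`steps_nonneg_gauge`**) along every base orbit `h = S y` the step quantities `X_m = B′(S′h_m) − B(S h_m)` are NON-NEGATIVE and `X_m·h_m²` is NON-INCREASING in the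
# depth `m`;  (**`effective_le_const`**) the effective β-functions are ordered at every pin, `B(S y) ≤ B′(S′y)`;  (**`le_of_const_excess`**, family-free) ANY box solutions
# `h`, `h′` of `B`, `B + η` from one pin satisfy `h′ ≤ h` at EVERY scale.  This is conjecture (E58′) of the comparison column for the CONSTANT excess — the case all the
# cell's step numerics address (`HOME/b2b-balaban-beta-d4-p2/g56/STRATEGY-E58prime.md` §3: the worst excess is a truncation of a constant) — with no profile condition,
# no ratio, no light load: (E57a) (one age), (E58b∕c) (profile condition), (E59e)∕(E63d) (two ages), (E60a) (fading), (E63b∕c∕e∕f) (towers, windows, zones) are superseded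
# for this excess.  NOT covered: non-constant isotone excesses (the excess modulus `ME` enters (E118b) `row_ge` as a defect `ME·h³∕2` per unit level gap; small `ME` is a
# sequel), Markov weight `L_0 > 0`.
#
# THE PROOF (README `HOME/b2b-balaban-beta-d4-p2/g98/README.md` §2).  ROW INDUCTION from the deep region upward on `P(n)`: «`X_m ≥ 0` and `X_{m+1}h_{m+1}² ≤ X_mh_m²` for all
# `m ≥ n`».  BASE: deep enough `u_n ≤ 1∕(5(K+1))` and the pins are small ((E118c) `exists_base_depth`); there `X ≥ 0` by the small-pin estimate (E49j)(1) and the gauge holds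
# by crude windows ((E118d) `base_gauge`).  STEP `P(n+1) ⟹ P(n)`: non-negative deeper step quantities give comparison in every configuration `m ≥ n` ((E118c) `cmp_of_steps_nonneg`);
# the NONLINEAR ROW INEQUALITY (E118b) `row_ge` (excess modulus `0`, `e ≡ η`) bounds `X_n` below by `(1 − F(n))X_{n+1}` minus (decay + defect `≤ F`) × configuration windows;
# the windows are level gaps `δ^{(n+1)}_{k−1} ≤ Σ_{j<k−1} X_{n+2+j}` ((E63a) `levelGap_le_sum_step`) `≤ X_{n+1}h_{n+1}²Σ_{1≤l<k} a_{n+1+l}` BY THE GAUGE BELOW; per age (E117a)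
# `flow_damped_age_ge_two_le` (the damped budget polynomial `Φ ≤ 0.95 ≤ 1`) and (E116c) `flow_age_one_le`; the row budget (E116b) `flow_budget_le` sums to
# `X_n ≥ X_{n+1}·a_n∕a_{n+1} ≥ 0`.  So the first-order machinery of (E116)∕(E117) runs VERBATIM on the exact nonlinear system once (E118a∕b) have signed every nonlinear
# correction — the statement (α) of `g97/README.md` §4 (1) is not needed (and false for steep excesses).

Cell `pub-balaban`, β-function sub-cell, BINDER row D4 «RemainderConst leaves for Bałaban's split» (`HOME/BINDER-OWNERS.md`; owner lineage `b2b-balaban-beta-an4`;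
this file by co-owner #2 lineage `b2b-balaban-beta-d4-p2`, generation 98), β-FLOW TEAM duty (1), FREEZE (0) honoured (def-free; imports (E118d) `…NonlinearLevelGaugeBase`;
uses (E118a–d) `affine_facts` ∕ `row_ge` ∕ `const_facts` ∕ `cmp_of_steps_nonneg` ∕ `exists_base_depth` ∕ `base_gauge`, (E117a) `flow_damped_age_ge_two_le`, (E116c)
`flow_age_one_le`, (E116b) `flow_budget_le`, (E63a) `levelGap_le_sum_step`, (E49j) `effective_le_of_small_pin`, (E49k) `family_le_of_orbit`, (E39) `exists_memFlow_zm`,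
(E43b) `memFlow_unique_of_monotone_zm`, (E48a) `family_mem` ∕ `family_tail_eq` ∕ `family_zero` ∕ `strictAnti_of_memFlow` BY NAME; nothing restated).

HONEST FRAMING (page 1, verbatim and binding).  *"Discharging BetaPertH makes Bałaban's UV stability UNCONDITIONAL — a real constructive-QFT result; it is
NOT the continuum limit and NOT the Clay problem."*  THIS FILE DISCHARGES NOTHING OF THE KIND.  Elementary real analysis about ABSTRACT functionals on a box
]0,γ]^ℕ with displayed floors, moduli, profiles and signs — hypotheses of a census, not facts; the form, signs, ages and moments of Bałaban's (1.22) limit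
functional (in particular whether its perturbations are constant excesses over an affine profile) are NOT PRINTED ([I] p. 298; GAPS G-t4-U2-1∕-2) and NOT
asserted.  Row D4 class UNCHANGED (critical-path width 0; instance 0∕1; D4 DISCHARGE NO DATE).  HONEST DEPENDENCY: continuum YM on T⁴ ⇐ BetaPertH ∧ nine spine
estimates (0/9 proved); BetaPertH ⇐ (D1) ∧ (D4) ∧ CAP+tail; G-an2-4 gates asym, D1 and NE2/3/4.  NOT B12 Thm 2, NOT BetaPertH, NOT continuum, NOT Clay.

WHAT IS PROVED ([folklore]; 0 `def`, 0 sorry).  §1 `gauge_chain`, `conf_window_le`, **`gauge_step`**.  §2 **`steps_nonneg_gauge`**.  §3 **`effective_le_const`**,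
**`le_of_const_excess`**.
-/

noncomputable section
open Finset Set

namespace Summit.QuantumFields.BalabanUV.Beta.EriceRemainderEnclosureHistoryAutonomyComparisonNonlinearLevelGauge

open Literature.MathematicalPhysics.QuantumFieldTheory.Balaban1983to89
open Literature.MathematicalPhysics.QuantumFieldTheory.Balaban1983to89.T4BetaStationary
open Literature.MathematicalPhysics.QuantumFieldTheory.Balaban1983to89.T4BetaFlowWellPosed
open Summit.QuantumFields.BalabanUV.Beta.EriceRemainderEnclosureHistoryAutonomyOrder (family_mem family_tail_eq family_zero strictAnti_of_memFlow)
open Summit.QuantumFields.BalabanUV.Beta.EriceRemainderEnclosureHistoryAutonomyComparisonExcess (effective_le_of_small_pin)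
open Summit.QuantumFields.BalabanUV.Beta.EriceRemainderEnclosureHistoryAutonomyComparisonIsotoneExcess (family_le_of_orbit)
open Summit.QuantumFields.BalabanUV.Beta.EriceRemainderEnclosureHistoryAutonomyExistence (exists_memFlow_zm)
open Summit.QuantumFields.BalabanUV.Beta.EriceRemainderEnclosureHistoryAutonomyMonotoneGeneral (memFlow_unique_of_monotone_zm)
open Summit.QuantumFields.BalabanUV.Beta.EriceRemainderEnclosureHistoryAutonomyComparisonDropBound (levelGap_le_sum_step)
open Summit.QuantumFields.BalabanUV.Beta.EriceRemainderEnclosureHistoryAutonomyComparisonAgeCompositionHeatingCriterionFlow (flow_budget_le)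
open Summit.QuantumFields.BalabanUV.Beta.EriceRemainderEnclosureHistoryAutonomyComparisonAgeCompositionLevelGaugePrep (flow_age_one_le)
open Summit.QuantumFields.BalabanUV.Beta.EriceRemainderEnclosureHistoryAutonomyComparisonAgeCompositionDampedLevelGaugePrep (flow_damped_age_ge_two_le)
open Summit.QuantumFields.BalabanUV.Beta.EriceRemainderEnclosureHistoryAutonomyComparisonNonlinearRowPrep (affine_facts)
open Summit.QuantumFields.BalabanUV.Beta.EriceRemainderEnclosureHistoryAutonomyComparisonNonlinearRow (row_ge)
open Summit.QuantumFields.BalabanUV.Beta.EriceRemainderEnclosureHistoryAutonomyComparisonNonlinearLevelGaugePrep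
  (const_facts cmp_of_steps_nonneg exists_base_depth)
open Summit.QuantumFields.BalabanUV.Beta.EriceRemainderEnclosureHistoryAutonomyComparisonNonlinearLevelGaugeBase (base_gauge)

variable {B B' : (ℕ → ℝ) → ℝ} {γ β₀ η : ℝ} {L : ℕ → ℝ} {K : ℕ} {S S' : ℝ → ℕ → ℝ}

/-! ## §1 The step of the row induction -/

/-- The gauge below a row chains: `X_{n+1+l}·h_{n+1+l}² ≤ X_{n+1}·h_{n+1}²`. [folklore] -/
theorem gauge_chain {X h : ℕ → ℝ} {n : ℕ} (hg : ∀ m, n + 1 ≤ m → X (m + 1) * h (m + 1) ^ 2 ≤ X m * h m ^ 2) :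
    ∀ l, X (n + 1 + l) * h (n + 1 + l) ^ 2 ≤ X (n + 1) * h (n + 1) ^ 2
  | 0 => by simp
  | l + 1 => by
    have h1 := hg (n + 1 + l) (by omega)
    rw [show n + 1 + (l + 1) = n + 1 + l + 1 by ring]
    exact h1.trans (gauge_chain hg l)

/-- **THE CONFIGURATION WINDOW THROUGH THE GAUGE.**  Configuration `n+1` (pin `h_{n+1}`) comparing, comparison from every deeper pin, and the gauge below the row:
`δ^{(n+1)}_j ≤ X_{n+1}·h_{n+1}²·Σ_{1≤l≤j} 1∕h_{n+1+l}²` ((E63a) `levelGap_le_sum_step`, term by term). [folklore] -/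
theorem conf_window_le (hBaff : ∀ u, SeqBox γ u → B u = β₀ + ∑ k ∈ range K, L k * u k) (hL : ∀ k, 0 ≤ L k) (hβ : 0 < β₀)
    (hB'eq : ∀ u, SeqBox γ u → B' u = B u + η) (hη : 0 ≤ η)
    (hS : ∀ p, 0 < p → p ≤ γ → SeqBox γ (S p) ∧ MemFlow B p (S p))
    (huniq : ∀ p, 0 < p → p ≤ γ → ∀ u u' : ℕ → ℝ, SeqBox γ u → SeqBox γ u' → MemFlow B p u → MemFlow B p u' → u = u')
    (hS' : ∀ p, 0 < p → p ≤ γ → SeqBox γ (S' p) ∧ MemFlow B' p (S' p))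
    (huniq' : ∀ p, 0 < p → p ≤ γ → ∀ u u' : ℕ → ℝ, SeqBox γ u → SeqBox γ u' → MemFlow B' p u → MemFlow B' p u' → u = u')
    {y : ℝ} (hy : 0 < y) (hyγ : y ≤ γ) (n : ℕ) (hcmp : ∀ j, S' (S y (n + 1)) j ≤ S y (n + 1 + j))
    (hg : ∀ m, n + 1 ≤ m → (B' (S' (S y (m + 1))) - B (S (S y (m + 1)))) * S y (m + 1) ^ 2 ≤ (B' (S' (S y m)) - B (S (S y m))) * S y m ^ 2)
    (j : ℕ) :
    1 / S' (S y (n + 1)) j ^ 2 - 1 / S y (n + 1 + j) ^ 2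
      ≤ (B' (S' (S y (n + 1))) - B (S (S y (n + 1)))) * S y (n + 1) ^ 2 * ∑ l ∈ Ico 1 (j + 1), 1 / S y (n + 1 + l) ^ 2 := by
  obtain ⟨hmono', hlo', hB', _, _, _⟩ := const_facts hBaff hL hβ hB'eq hη
  have hM' : 0 ≤ ∑ k ∈ range K, L k := sum_nonneg fun k _ => hL k
  have hq := family_mem hS hy hyγ (n + 1)
  have hpos : ∀ i, 0 < S y i := fun i => ((hS y hy hyγ).1 i).1
  have htail : ∀ i, S (S y (n + 1)) i = S y (n + 1 + i) := fun i => (congrFun (family_tail_eq hS huniq hy hyγ (n + 1)) i).symm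
  have hle : ∀ i, S' (S y (n + 1)) i ≤ S (S y (n + 1)) i := fun i => by rw [htail i]; exact hcmp i
  have h1 := levelGap_le_sum_step hmono' hβ hB' hM' hlo' hS huniq hS' huniq' (hS _ hq.1 hq.2).1 (hS _ hq.1 hq.2).2
    (hS' _ hq.1 hq.2).1 (hS' _ hq.1 hq.2).2 hle j
  rw [htail j] at h1
  refine h1.trans ?_
  have hchain := gauge_chain (X := fun m => B' (S' (S y m)) - B (S (S y m))) (h := S y) hg
  rw [mul_sum, sum_Ico_eq_sum_range, show j + 1 - 1 = j from rfl]
  refine sum_le_sum fun l _ => ?_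
  rw [htail (l + 1), show n + 1 + (1 + l) = n + 1 + (l + 1) by ring]
  have hc := hchain (l + 1)
  have hp2 : 0 < S y (n + 1 + (l + 1)) ^ 2 := pow_pos (hpos _) 2
  rw [mul_one_div, le_div_iff₀ hp2]
  simpa using hc

set_option maxHeartbeats 800000 in
/-- **THE STEP OF THE ROW INDUCTION.**  If `X_m ≥ 0` and `X_{m+1}h_{m+1}² ≤ X_mh_m²` for all `m ≥ n+1`, then `X_{n+1}h_{n+1}² ≤ X_nh_n²` (hence `X_n ≥ 0`):
(E118b) `row_ge` + `conf_window_le` + (E117a) `flow_damped_age_ge_two_le` (defect `θ = F(n+k+1)`) + (E116c) `flow_age_one_le` + (E116b) `flow_budget_le`. [folklore] -/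
theorem gauge_step (hBaff : ∀ u, SeqBox γ u → B u = β₀ + ∑ k ∈ range K, L k * u k) (hL : ∀ k, 0 ≤ L k) (hL0 : L 0 = 0) (hβ : 0 < β₀)
    (hB'eq : ∀ u, SeqBox γ u → B' u = B u + η) (hη : 0 ≤ η)
    (hS : ∀ p, 0 < p → p ≤ γ → SeqBox γ (S p) ∧ MemFlow B p (S p))
    (huniq : ∀ p, 0 < p → p ≤ γ → ∀ u u' : ℕ → ℝ, SeqBox γ u → SeqBox γ u' → MemFlow B p u → MemFlow B p u' → u = u')
    (hS' : ∀ p, 0 < p → p ≤ γ → SeqBox γ (S' p) ∧ MemFlow B' p (S' p))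
    (huniq' : ∀ p, 0 < p → p ≤ γ → ∀ u u' : ℕ → ℝ, SeqBox γ u → SeqBox γ u' → MemFlow B' p u → MemFlow B' p u' → u = u')
    {y : ℝ} (hy : 0 < y) (hyγ : y ≤ γ) (n : ℕ) (hX : ∀ m, n + 1 ≤ m → 0 ≤ B' (S' (S y m)) - B (S (S y m)))
    (hg : ∀ m, n + 1 ≤ m → (B' (S' (S y (m + 1))) - B (S (S y (m + 1)))) * S y (m + 1) ^ 2 ≤ (B' (S' (S y m)) - B (S (S y m))) * S y m ^ 2) :
    (B' (S' (S y (n + 1))) - B (S (S y (n + 1)))) * S y (n + 1) ^ 2 ≤ (B' (S' (S y n)) - B (S (S y n))) * S y n ^ 2 := by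
  obtain ⟨hmono', hlo', hB', _, _, hEmod⟩ := const_facts hBaff hL hβ hB'eq hη
  obtain ⟨hmono, hlo, hdom, _⟩ := affine_facts hBaff hL hβ
  have hM' : 0 ≤ ∑ k ∈ range K, L k := sum_nonneg fun k _ => hL k
  have hh := (hS y hy hyγ).1
  have hf := (hS y hy hyγ).2
  have hpos : ∀ j, 0 < S y j := fun j => (hh j).1
  have hcmp := cmp_of_steps_nonneg hBaff hL hβ hB'eq hη hS huniq hS' huniq' hy hyγ n hX
  set X1 : ℝ := B' (S' (S y (n + 1))) - B (S (S y (n + 1))) with hX1def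
  have hX10 : 0 ≤ X1 := hX (n + 1) le_rfl
  have he : ∀ m, B' (S' (S y m)) - B (S' (S y m)) = η := fun m => by
    have hq := family_mem hS hy hyγ m; rw [hB'eq _ (hS' _ hq.1 hq.2).1]; ring
  have hrow := row_ge hBaff hL hL0 hβ hmono' hβ hB' hM' hlo' hEmod le_rfl hS huniq hS' huniq' hy hyγ n hcmp hX
  rw [he n, he (n + 1), sub_self, zero_add] at hrow
  have hq1 := family_mem hS hy hyγ (n + 1)
  have hwin := conf_window_le hBaff hL hβ hB'eq hη hS huniq hS' huniq' hy hyγ n (hcmp (n + 1) (by omega)) hg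
  -- per-age costs
  have hcost : ∑ k ∈ Ico 1 K, L k * S y (n + k) ^ 3 / 2 * X1
      + ∑ k ∈ Ico 1 K, (L k * S y (n + k) ^ 3 / 2 - L k * S y (n + 1 + k) ^ 3 / 2
          + L k * S y (n + 1 + k) ^ 3 / 2 * (∑ q ∈ Ico 1 K, L q * S y (n + k + 1 + q) ^ 3 / 2 + 0 * S y (n + k + 1) ^ 3 / 2))
          * (1 / S' (S y (n + 1)) (k - 1) ^ 2 - 1 / S y (n + k) ^ 2)
      ≤ (∑ k ∈ Ico 1 K, L k * S y (n + 1 + k)) * S y (n + 1) ^ 2 * X1 := by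
    rw [← sum_add_distrib, sum_mul, sum_mul]
    refine sum_le_sum fun k hk => ?_
    have hk1 : 1 ≤ k := (mem_Ico.mp hk).1
    rw [zero_mul, zero_div, add_zero]
    by_cases hk2 : 2 ≤ k
    · obtain ⟨j, rfl⟩ : ∃ j, k = j + 1 := ⟨k - 1, by omega⟩
      simp only [Nat.add_sub_cancel]
      have hS0 : 0 ≤ 1 / S' (S y (n + 1)) j ^ 2 - 1 / S y (n + (j + 1)) ^ 2 := by
        have hc := hcmp (n + 1) (by omega) j; rw [show n + 1 + j = n + (j + 1) by ring] at hc
        have hwp := ((hS' _ hq1.1 hq1.2).1 j).1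
        exact sub_nonneg.mpr (one_div_le_one_div_of_le (pow_pos hwp 2) (pow_le_pow_left₀ hwp.le hc 2))
      have hSw : 1 / S' (S y (n + 1)) j ^ 2 - 1 / S y (n + (j + 1)) ^ 2 ≤ X1 * S y (n + 1) ^ 2 * ∑ l ∈ Ico 1 (j + 1), 1 / S y (n + 1 + l) ^ 2 := by
        have := hwin j; rwa [show n + 1 + j = n + (j + 1) by ring] at this
      have hθ0 : 0 ≤ ∑ q ∈ Ico 1 K, L q * S y (n + (j + 1) + 1 + q) ^ 3 / 2 :=
        sum_nonneg fun q _ => by have := hL q; have := hpos (n + (j + 1) + 1 + q); positivity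
      have := flow_damped_age_ge_two_le hmono hL hβ hlo hdom hh hf n hk2 hX10 hS0 hSw hθ0 le_rfl
      linarith
    · have hk1' : k = 1 := by omega
      subst hk1'
      have hzero : 1 / S' (S y (n + 1)) (1 - 1) ^ 2 - 1 / S y (n + 1) ^ 2 = 0 := by
        rw [show (1 : ℕ) - 1 = 0 from rfl, family_zero hS' hq1.1 hq1.2]; ring
      rw [hzero, mul_zero, add_zero]
      have := flow_age_one_le hmono hL hβ hlo hh hf n
      exact mul_le_mul_of_nonneg_right (by linarith) hX10
  -- the budget of the row
  have hbud : ∑ k ∈ Ico 1 K, L k * S y (n + 1 + k) ≤ 1 / S y (n + 1) ^ 2 - 1 / S y n ^ 2 := by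
    refine le_trans ?_ (flow_budget_le hdom hh hf n)
    exact sum_le_sum_of_subset_of_nonneg (fun k hk => mem_range.mpr (mem_Ico.mp hk).2) fun k _ _ => mul_nonneg (hL k) (hpos _).le
  have hn2 : 0 < S y n ^ 2 := pow_pos (hpos n) 2
  have hn12 : 0 < S y (n + 1) ^ 2 := pow_pos (hpos (n + 1)) 2
  have hstep : X1 * S y (n + 1) ^ 2 * (1 / S y n ^ 2) ≤ B' (S' (S y n)) - B (S (S y n)) := by
    have h1 : (∑ k ∈ Ico 1 K, L k * S y (n + 1 + k)) * S y (n + 1) ^ 2 * X1 ≤ (1 / S y (n + 1) ^ 2 - 1 / S y n ^ 2) * S y (n + 1) ^ 2 * X1 :=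
      mul_le_mul_of_nonneg_right (mul_le_mul_of_nonneg_right hbud hn12.le) hX10
    have e0 : (1 / S y (n + 1) ^ 2 - 1 / S y n ^ 2) * S y (n + 1) ^ 2 = 1 - S y (n + 1) ^ 2 * (1 / S y n ^ 2) := by
      rw [sub_mul, one_div_mul_cancel (ne_of_gt hn12), mul_comm]
    rw [e0] at h1
    have hF : (∑ k ∈ Ico 1 K, L k * S y (n + k) ^ 3 / 2) * X1 = ∑ k ∈ Ico 1 K, L k * S y (n + k) ^ 3 / 2 * X1 := by rw [sum_mul]
    nlinarith [hrow, hcost, h1, hF]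
  have e2 : X1 * S y (n + 1) ^ 2 * (1 / S y n ^ 2) * S y n ^ 2 = X1 * S y (n + 1) ^ 2 := by
    rw [mul_assoc, one_div_mul_cancel (ne_of_gt hn2), mul_one]
  have := mul_le_mul_of_nonneg_right hstep hn2.le
  rw [e2] at this
  exact this

/-! ## §2 The nonlinear level gauge along every orbit -/

/-- **THE NONLINEAR LEVEL GAUGE.**  `B u = β₀ + Σ_{k<K} L_k·u_k` (`β₀ > 0`, `L ≥ 0`, `L_0 = 0`), `B′ = B + η` (`η ≥ 0`), solution families `S`, `S′` (unique).  Along every base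
orbit `h = S y`, `y ∈ ]0,γ]`:  `X_m ≥ 0` and `X_{m+1}·h_{m+1}² ≤ X_m·h_m²` at EVERY depth `m` (row induction from the deep region: (E118c) `exists_base_depth`, (E49j)
`effective_le_of_small_pin`, (E118d) `base_gauge`; step `gauge_step`). [folklore] -/
theorem steps_nonneg_gauge (hBaff : ∀ u, SeqBox γ u → B u = β₀ + ∑ k ∈ range K, L k * u k) (hL : ∀ k, 0 ≤ L k) (hL0 : L 0 = 0) (hβ : 0 < β₀)
    (hB'eq : ∀ u, SeqBox γ u → B' u = B u + η) (hη : 0 ≤ η)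
    (hS : ∀ p, 0 < p → p ≤ γ → SeqBox γ (S p) ∧ MemFlow B p (S p))
    (huniq : ∀ p, 0 < p → p ≤ γ → ∀ u u' : ℕ → ℝ, SeqBox γ u → SeqBox γ u' → MemFlow B p u → MemFlow B p u' → u = u')
    (hS' : ∀ p, 0 < p → p ≤ γ → SeqBox γ (S' p) ∧ MemFlow B' p (S' p))
    (huniq' : ∀ p, 0 < p → p ≤ γ → ∀ u u' : ℕ → ℝ, SeqBox γ u → SeqBox γ u' → MemFlow B' p u → MemFlow B' p u' → u = u')
    {y : ℝ} (hy : 0 < y) (hyγ : y ≤ γ) :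
    ∀ m, 0 ≤ B' (S' (S y m)) - B (S (S y m))
      ∧ (B' (S' (S y (m + 1))) - B (S (S y (m + 1)))) * S y (m + 1) ^ 2 ≤ (B' (S' (S y m)) - B (S (S y m))) * S y m ^ 2 := by
  obtain ⟨hmono', hlo', hB', hexc, hDmono, _⟩ := const_facts hBaff hL hβ hB'eq hη
  obtain ⟨hmono, hlo, hdom, hBmod⟩ := affine_facts hBaff hL hβ
  have hM : 0 ≤ ∑ k ∈ range K, L k := sum_nonneg fun k _ => hL k
  have hh := (hS y hy hyγ).1
  have hf := (hS y hy hyγ).2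
  have hpos : ∀ j, 0 < S y j := fun j => (hh j).1
  -- the deep region
  obtain ⟨N₀, hN₀⟩ := exists_base_depth hBaff hL hβ hh hf
  have hXdeep : ∀ m, N₀ ≤ m → 0 ≤ B' (S' (S y m)) - B (S (S y m)) := by
    intro m hm
    have hq := family_mem hS hy hyγ m
    have hsmall := (hN₀ m hm).2
    have := effective_le_of_small_pin hBmod hM hβ hlo hexc hDmono hq.1 hq.2 hsmall (hS _ hq.1 hq.2).1 (hS _ hq.1 hq.2).2
      (hS' _ hq.1 hq.2).1 (hS' _ hq.1 hq.2).2
    linarith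
  -- P(n): non-negativity and the gauge at every m ≥ n
  have hP : ∀ d n, N₀ ≤ n + d → ∀ m, n ≤ m → 0 ≤ B' (S' (S y m)) - B (S (S y m))
      ∧ (B' (S' (S y (m + 1))) - B (S (S y (m + 1)))) * S y (m + 1) ^ 2 ≤ (B' (S' (S y m)) - B (S (S y m))) * S y m ^ 2 := by
    intro d
    induction d with
    | zero =>
      intro n hn m hm
      rw [add_zero] at hn
      refine ⟨hXdeep m (hn.trans hm), ?_⟩
      exact base_gauge hBaff hL hL0 hβ hB'eq hη hS huniq hS' huniq' hy hyγ m (hN₀ m (hn.trans hm)).1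
        (cmp_of_steps_nonneg hBaff hL hβ hB'eq hη hS huniq hS' huniq' hy hyγ m fun m' hm' => hXdeep m' (by omega))
        fun m' hm' => hXdeep m' (by omega)
    | succ d ih =>
      intro n hn m hm
      have ih' := ih (n + 1) (by omega)
      by_cases hm1 : n + 1 ≤ m
      · exact ih' m hm1
      · have hmn : m = n := by omega
        subst hmn
        have hXb : ∀ m', m + 1 ≤ m' → 0 ≤ B' (S' (S y m')) - B (S (S y m')) := fun m' hm' => (ih' m' hm').1
        have hgb : ∀ m', m + 1 ≤ m' → (B' (S' (S y (m' + 1))) - B (S (S y (m' + 1)))) * S y (m' + 1) ^ 2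
            ≤ (B' (S' (S y m')) - B (S (S y m'))) * S y m' ^ 2 := fun m' hm' => (ih' m' hm').2
        have hgs := gauge_step hBaff hL hL0 hβ hB'eq hη hS huniq hS' huniq' hy hyγ m hXb hgb
        refine ⟨?_, hgs⟩
        have h1 : 0 ≤ (B' (S' (S y (m + 1))) - B (S (S y (m + 1)))) * S y (m + 1) ^ 2 := mul_nonneg (hXb (m + 1) le_rfl) (sq_nonneg _)
        have h2 : 0 < S y m ^ 2 := pow_pos (hpos m) 2
        nlinarith
  intro m
  exact hP N₀ 0 (by omega) m (Nat.zero_le m)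

/-! ## §3 Comparison at any size for the constant excess -/

/-- **THE EFFECTIVE β-FUNCTIONS OF `B` AND `B + η` ARE ORDERED AT EVERY PIN**: `B(S y) ≤ (B + η)(S′y)` for every `y ∈ ]0,γ]` — the affine profile, its range and
all sizes arbitrary. [folklore] -/
theorem effective_le_const (hBaff : ∀ u, SeqBox γ u → B u = β₀ + ∑ k ∈ range K, L k * u k) (hL : ∀ k, 0 ≤ L k) (hL0 : L 0 = 0) (hβ : 0 < β₀)
    (hB'eq : ∀ u, SeqBox γ u → B' u = B u + η) (hη : 0 ≤ η)
    (hS : ∀ p, 0 < p → p ≤ γ → SeqBox γ (S p) ∧ MemFlow B p (S p))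
    (huniq : ∀ p, 0 < p → p ≤ γ → ∀ u u' : ℕ → ℝ, SeqBox γ u → SeqBox γ u' → MemFlow B p u → MemFlow B p u' → u = u')
    (hS' : ∀ p, 0 < p → p ≤ γ → SeqBox γ (S' p) ∧ MemFlow B' p (S' p))
    (huniq' : ∀ p, 0 < p → p ≤ γ → ∀ u u' : ℕ → ℝ, SeqBox γ u → SeqBox γ u' → MemFlow B' p u → MemFlow B' p u' → u = u') :
    ∀ y, 0 < y → y ≤ γ → B (S y) ≤ B' (S' y) := by
  intro y hy hyγ
  have := (steps_nonneg_gauge hBaff hL hL0 hβ hB'eq hη hS huniq hS' huniq' hy hyγ 0).1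
  rw [family_zero hS hy hyγ] at this
  linarith

/-- **COMPARISON AT ANY SIZE FOR THE CONSTANT EXCESS (conjecture (E58′) for `B′ = B + η`), family-free form.**  `B u = β₀ + Σ_{k<K} L_k·u_k` on the box ]0,γ] with
`β₀ > 0`, `L ≥ 0`, `L_0 = 0` — the profile, the range `K` and ALL SIZES ARBITRARY; `B′ = B + η` on the box, `η ≥ 0`; `h`, `h′` ANY box solutions of `B`, `B′` from one pin
`p ∈ ]0,γ]`.  Then `h′ ≤ h` at EVERY scale.  ((E39) existence and (E43b) uniqueness of the solution families at any size, `effective_le_const`, (E49k) `family_le_of_orbit`.) [folklore] -/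
theorem le_of_const_excess {p : ℝ} {h h' : ℕ → ℝ} (hBaff : ∀ u, SeqBox γ u → B u = β₀ + ∑ k ∈ range K, L k * u k) (hL : ∀ k, 0 ≤ L k)
    (hL0 : L 0 = 0) (hβ : 0 < β₀) (hB'eq : ∀ u, SeqBox γ u → B' u = B u + η) (hη : 0 ≤ η)
    (hp : 0 < p) (hpγ : p ≤ γ) (hh : SeqBox γ h) (hf : MemFlow B p h) (hh' : SeqBox γ h') (hf' : MemFlow B' p h') (j : ℕ) :
    h' j ≤ h j := by
  obtain ⟨hmono', hlo', hB', _, _, _⟩ := const_facts hBaff hL hβ hB'eq hη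
  obtain ⟨hmono, hlo, _, hBmod⟩ := affine_facts hBaff hL hβ
  have hM : 0 ≤ ∑ k ∈ range K, L k := sum_nonneg fun k _ => hL k
  have hγ : 0 < γ := hp.trans_le hpγ
  have hex : ∀ q : ℝ, 0 < q → q ≤ γ → ∃ k : ℕ → ℝ, SeqBox γ k ∧ MemFlow B q k := fun q hq hqγ => exists_memFlow_zm hBmod hM hq hqγ hβ hlo
  have hex' : ∀ q : ℝ, 0 < q → q ≤ γ → ∃ k : ℕ → ℝ, SeqBox γ k ∧ MemFlow B' q k := fun q hq hqγ => exists_memFlow_zm hB' hM hq hqγ hβ hlo'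
  choose! S hSb hSf using hex
  choose! S' hS'b hS'f using hex'
  have hS : ∀ q, 0 < q → q ≤ γ → SeqBox γ (S q) ∧ MemFlow B q (S q) := fun q hq hqγ => ⟨hSb q hq hqγ, hSf q hq hqγ⟩
  have hS' : ∀ q, 0 < q → q ≤ γ → SeqBox γ (S' q) ∧ MemFlow B' q (S' q) := fun q hq hqγ => ⟨hS'b q hq hqγ, hS'f q hq hqγ⟩
  have huniq : ∀ q, 0 < q → q ≤ γ → ∀ u u' : ℕ → ℝ, SeqBox γ u → SeqBox γ u' → MemFlow B q u → MemFlow B q u' → u = u' :=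
    fun q hq _ u u' hu hu' hfu hfu' => memFlow_unique_of_monotone_zm hmono hBmod hM hq hβ hlo hu hu' hfu hfu'
  have huniq' : ∀ q, 0 < q → q ≤ γ → ∀ u u' : ℕ → ℝ, SeqBox γ u → SeqBox γ u' → MemFlow B' q u → MemFlow B' q u' → u = u' :=
    fun q hq _ u u' hu hu' hfu hfu' => memFlow_unique_of_monotone_zm hmono' hB' hM hq hβ hlo' hu hu' hfu hfu'
  have e : h = S p := huniq p hp hpγ _ _ hh (hS p hp hpγ).1 hf (hS p hp hpγ).2
  have e' : h' = S' p := huniq' p hp hpγ _ _ hh' (hS' p hp hpγ).1 hf' (hS' p hp hpγ).2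
  rw [e, e']
  exact family_le_of_orbit hβ hγ hB' hM hlo' hS huniq hS' huniq' ⟨hp, hpγ⟩ (fun i _ =>
    effective_le_const hBaff hL hL0 hβ hB'eq hη hS huniq hS' huniq' _ (family_mem hS hp hpγ i).1 (family_mem hS hp hpγ i).2) j

end Summit.QuantumFields.BalabanUV.Beta.EriceRemainderEnclosureHistoryAutonomyComparisonNonlinearLevelGauge

end
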